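import Mathlib
import HarnessLib
import HarnessLib.Audit
import Summits.NavierStokesRegularity.Statement
import Literature.Analysis.FluidPDE.Tao2016AveragedNS.SelfSimilarCascadeBlowup
import Summits.NavierStokesRegularity.NavierStokesRegularity.Theses.TaoLadderRungTwoBreak
import Summits.NavierStokesRegularity.NavierStokesRegularity.Theorems.OrthantWakeForwardSourceSmoothing

/-!
Route: SubcriticalEnvelope

DORMANT since 2026-09-04T06:19:35Z (reconciler: no traction for 5 d (last activity statement-checked at 2026-08-30T05:36:41Z); parked, not closed — `ledger route dormant route-NavierStokesRegularity-SubcriticalEnvelope --off` to reactiv) — unstaffed, not closed; items shared with open routes are served there. `ledger route dormant <id> --off` reactivates.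

# Route SubcriticalEnvelope — A viscosity-uniform subcritical envelope of the FORWARD-SOURCE tail
energy at small scale ratio makes every KP-network viscous cascade lattice stall (rev 8: KP networks
proper; declared residuals = sign-mixing tables and the non-diagonal orthant pocket)

LINE (D-0145 ideator ns-idea-1; opened g2-2, repaired g5-1, functional changed g5-2) on rung
TL-M2Break (MODEL lattice; no summit and no Clay statement is proved by a line). It suffices to show
UNIFORM VISCOUS STALL: for every spread R ≥ 1 there is ε_R > 0 such that for every scale ratio 1+ε₀
with ε₀ ≤ ε_R, every R-comparable symmetric cancelling four-mode table (orthant or sign-mixing),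
every one-shell datum and EVERY viscosity ν > 0, the NS-scaled viscous cascade lattice has a global
regular solution (tree predicate `ViscousStall R`; `noRobustBlowupBelow_of_viscousStall` turns it
into the rung). X is decomposed FORWARD IN TIME over the honest viscous family, through a MONOTONE
QUANTITY that the dead-end witness of CENSUS-24639-v3 cannot load: the FORWARD-SOURCE tail energy
T⁺_n = Σ_{k≥n} Σ_{i∈S} ½X_{i,k}², S ⊇ S⁺(α) = {i : ∃ j l, α i j l (0,0,1) ≠ 0}. Only μ = (0,0,1)
terms of `quadTerm` drive a shell from strictly lower shells, and their sources are exactly S⁺(α); a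
two-shell triad with vanishing (0,0,1) coefficient is a rotor inside the lower shell by (4.2)–(4.3).
Energy parked in diode-fed dead-end modes (the T₁₀ mechanism: W = 0.20–0.47 for the TOTAL tail
energy down to ε₀ = 1/64, band growing as ν ↓) is therefore inert and is not counted. X ⇐
ForwardSourceTailEnvelope (crux A⁺, rank 2: ∀ R ≥ 1 ∃ εs ∀ ε₀ ≤ εs ∀ α ∈ E₂(R) ∃ S ⊇ S⁺(α) ∀ X₀ ∃ η
> 0 ∀ T ∃ C ∀ ν: every regular ν-viscous solution on [0,s], s ≤ T, has Σ_{k=n..N} Σ_{i∈S}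
½X_{i,k}(t)² ≤ C(1+ε₀)^(−(1+η)n)) ∧ ForwardSourceSmoothing (crux B⁺, rank 3: at fixed ν a
subcritical T⁺-envelope on sub-windows already gives `ViscousGlobal` — the landed engine
`exists_viscousGlobal_of_subcriticalEnvelope` extended by the slaving of non-source modes). The
earlier items stay in the file as asides, never reworded in place: SubcriticalTailEnvelope
(stmt-23973, negative edge p591070, pseudo-solution class), EnvelopeSmoothing (stmt-24008, vacuous
as filed), ViscousTailEnvelope (stmt-26128, A‴ = A⁺ with S = all modes: numerically false-in-waiting
on the orthant dead-end table T₁₀ ∈ E₂(10), CENSUS-24639-v3 §C.3), ViscousEnvelopeSmoothing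
(stmt-26132, proved fact `envelopeSmoothing_viscousFamily` p593538, the S = univ case of B⁺),
StallOfEnvelope / Assembly (proved rev-2 glue). SMALL-RATIO claim (ε₀ ≤ εs(R) ≲ c/R² at FIXED
spread), not a λ ≥ 2 statement.
REV 8 (g5-7, 2026-08-28 ≈09:30Z): the rev-5/7 crux ForwardSourceTailEnvelope (stmt-26373, all
tables, syntactic S⁺) is DEAD AS TYPED by the TWIN-EMBEDDING witness of idea-crit-3 / ns-ow-p1 g4
(exact algebra): the orthant table of E₂(17) obtained from α_SB by splitting the pocket feed into
twins x_1² → x_2′ (3/25), x_1² → x_3′ (4/25) plus the differential feed (4x_2 − 3x_3)²/16 → x_0′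
embeds every α_SB solution (X̃ = (X_0, X_1, (3/5)X_2, (4/5)X_2)), forces S = univ and T⁺ ≡
T_total(α_SB) with Θ → 5/9 < 1 on the ν-growing band beyond the inviscid front time, so no ν-uniform
window constant exists there; 26373 stays in the file as that settled negative (aside, never
reworded). REPAIR: ForwardSourceTailEnvelopeKP (stmt-27130) = A⁺ verbatim on KP NETWORKS PROPER
(orthant sign condition ∧ diagonal forward feed forms «∀ a b i, a ≠ b → α a b i (0,0,1) = 0»; all 87
+ 61 + 26 instrument rows of record lie in this class, min Θ⁺ beyond κ 2 = 1.008), the WEAKEST of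
the three KP-class statements now on the ledger (KPBlockWake 26999 ⇒ ForwardTailCeilingKP 27057 ⇒
A⁺_KP); the complement is carried by two DECLARED RESIDUALS shared with OrthantWake /
SubOnsagerCeiling: NonOrthantBreak (stmt-24640; the former «mixing half» of A⁺) and
NonDiagonalOrthantBreak (stmt-27000; the twin pocket; recorded plan: basis-free source space V⁺ = (⋂
ker A_i)^⊥ + rotation covariance). The new `closes` is per table: on a KP table A⁺_KP +
ForwardSourceSmoothing (26374, PROVED) give a global regular viscous solution for every ν, hence
HasGlobal at every κ (hasGlobal_of_viscousGlobal, hasGlobal_mono) and ¬NoGlobalCascade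
(noGlobalCascade_iff_kappa); elsewhere the residuals.

Lean: `ForwardSourceTailEnvelopeKP → ForwardSourceSmoothing → NonDiagonalOrthantBreak →
NonOrthantBreak →
Summit.NavierStokesRegularity.NavierStokesRegularity.Theses.TaoLadderRungTwoBreak.Target`

## Assembly
PROVED in glue.lean (`closes`, kernel-checked with Sketch9: rc 0, 0 sorries): fix R ≥ 1; A⁺_KP gives
ε₁, NonDiagonalOrthantBreak ε₃, NonOrthantBreak ε₂; take εR = min ε₁ (min ε₃ ε₂); for ε₀ ≤ εR split
`by_cases` on the orthant sign predicate of α and, inside, on the diagonal-feed predicate. KP table: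
A⁺_KP yields S ⊇ S⁺(α), η(X₀) and window constants uniform in ν; ForwardSourceSmoothing turns them
into a global regular ν-viscous solution for every ν > 0; `noGlobalCascade_iff_kappa` +
`hasGlobal_of_viscousGlobal` (with ν = κ/√2) + `hasGlobal_mono` give ¬NoGlobalCascade ε₀ α X₀.
Non-diagonal orthant → residual #2; sign-mixing → residual #1. CONJUNCT SPLIT (declared): attacked =
KP conjunct; residuals = NonOrthantBreak (stmt-24640), NonDiagonalOrthantBreak (stmt-27000).

CLOSES_TARGET: closes rung TL-M2Break of NavierStokesRegularity: Summit.NavierStokesRegularity.NavierStokesRegularity.Theses.TaoLadderRungTwoBreak.Target (D-0061; not the summit Statement) — the deciding theorem of this route concludes that registered leaf instead of the Statement decl `NavierStokesRegularity` (class rung: servable and labelled, never counted as concluding the summit Statement).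

Rationale: WHY THIS LINE. Every other open route on this rung (host TaoLadderRungTwoBreak, WakeRatchet,
LatticeTransitLiouville, TransitMassLedger) runs through ETERNAL SOLUTIONS (a Liouville half plus
the extraction crux K2ᵛ = EternalRigidityViscBddOne, carrying theory-2's N-39). This line decides
the rung forward in time through the tree's `ViscousStall` normal form
(`noRobustBlowupBelow_iff_stallable`, `hasGlobal_of_viscousGlobal`, `hasGlobal_mono`): a forward
a-priori estimate on the honest viscous family suffices. rev 5 changes the MONOTONE QUANTITY, not
the constants: CENSUS-24639-v3 (ns-ow-p1 g2; orthant table T₁₀ ∈ E₂(10) = chain + in-shell side mode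
+ re-entry + diode-fed DEAD END, entries ±1, ±1/2, ±0.2, ±0.1) shows that every functional of the
TOTAL tail energy with constants before ν is supercritical on T₁₀ (per-hop exponent W =
0.20/0.23/0.33/0.47 at ε₀ = 1/8, 1/16, 1/32, 1/64 for the smallest ν, W·ε₀ ∝ ε₀: the dead ends take
a constant fraction ≈ 0.4 of the passing energy per unit κ = nε₀ and keep it), which numerically
kills OrthantHopWake 24639 as typed, predicts OrthantTailCeiling 25507 refuted-misstated, and makes
the g5-1 crux ViscousTailEnvelope 26128 false-in-waiting for every εs — while the RUNG is untouched:
parked energy never moves up a shell. The structural fact behind the new functional: in Tao's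
`quadTerm` only the μ = (0,0,1) terms drive shell n from shell n−1, their sources are the forward
sources S⁺(α) = {i : ∃ j l, α i j l (0,0,1) ≠ 0} (both sources, by the symmetry (4.2)), and a
two-shell triad whose (0,0,1) coefficient vanishes is forced by (4.2)–(4.3) to be a rotor inside the
lower shell catalysed by the upper amplitude (coefficients a, −a), moving no energy up. So the
forward-source tail energy T⁺ is what a smoothing bootstrap actually consumes, and what a front
actually carries: on T₁₀, S⁺ = {0,1}, the dead-end mode 2 is dropped and the side mode 1 is damped
by its own parked exit (−c x₁ x₂ with x₂ ≥ 0 frozen), so T⁺ runs as the conveyor the census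
describes; on exit-complete tables (dyadic D, C2, C4, B3, B2f, capacitor pockets: W = 1.23–1.9) T⁺ =
T. ν-UNIFORMITY stays the content (C after ν = global existence reworded via `viscousFlow_unique`
p593837; C before T = the refuted rev-0 shape). Imported: BMR 2011 (BarbatoMorandinRomito2011),
Cheskidov–Zaya (doi:10.1090/proc/12494, arXiv:1310.7612 Thm 4.1), Tao2016AveragedNS §4, the tree's
damped-lattice engine (p591725, p592033, p592389, p593070, p593260). Nothing here is about the
Navier–Stokes equations.

RANKED CRUXES. #2 ForwardSourceTailEnvelopeKP (crux, stmt-27130, A⁺_KP, NEW rev 8) — ν-UNIFORM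
SUBCRITICAL ENVELOPE OF THE FORWARD-SOURCE TAIL ENERGY ON KP NETWORKS PROPER: ∀ R ≥ 1 ∃ εs > 0 ∀ ε₀
≤ εs ∀ α ∈ E₂(R) orthant with diagonal forward feed forms ∃ S ⊇ S⁺(α) ∀ X₀ ∃ η > 0 ∀ T ∃ C ∀ ν > 0:
every regular ν-viscous lattice solution on [0,s], s ≤ T, has Σ_(k=n..N) Σ_(i∈S) ½X_(i,k)(t)² ≤
C(1+ε₀)^(−(1+η)n). [difficulty: XL] (why it might fail: a KP network whose source modes keep
ν-uniformly critical standing energy behind the front within a fixed window — capacitor re-entry at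
an ε₀-small rate, or the dumbbell-type exponent W(ε₀) → 1 as ε₀ → 0 (1.233 at 1/8, 1.266 at 1/16;
1/64 pending kit j303108).) [Tao2016AveragedNS, BarbatoMorandinRomito2011, arXiv:1310.7612,
doi:10.1090/proc/12494, CENSUS-24639-v3, kit:j302483, kit:j303295, kit:j303489]. BC7 CLEAN
(P1/P2/P2h/P5 ok); BC2 both directions fail (folder repair8/bc). Implied by ForwardTailCeilingKP
(27057, θ > 1/2 ⇒ η = 2θ − 1, C·E₀) and by KPBlockWake (26999) — the weakest KP-class statement on
the ledger. STATE OF RECORD (rev 10, 2026-08-28; KEY-NS #122 (2)/#124/#138, DIRECTOR-NS #204 (6)):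
OPEN-WITH-LINE via 27057 — skeleton of record «via-ceiling» (LEAD ns-senv-p1; one stub =
SubOnsagerCeiling's ForwardTailCeilingKP BY NAME; composition
`forwardSourceTailEnvelopeKP_of_forwardTailCeilingKP` LANDED p622470) and, redundantly, via the
PARKED 26999 (`forwardSourceTailEnvelopeKP_of_kpBlockWake` p624862, S := S⁺(α): both implications
are PROVED as typed, no binder repair); BC5 rungs in the kernel:
`forwardSourceTailEnvelopeKP_at_dyadicRatioTwo` (p625250, ε₀ = 1) and
`forwardSourceTailEnvelopeKP_at_dyadicRange` (soc-p2 p626892, every ε₀ ∈ [7/10, 1], from the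
ν-uniform θ = 101/200 region `dyadicRange_shellBarrierAt` p625959); glue
`sTailCeiling_of_sShellBarrier` (p626948: S-restricted weighted shell barrier ⇒ S-partial tail
ceiling, route-predicate-free). No structural hour is spent on 27130 itself: the cluster's ONE
structural plan is 27057's «kp-shell-barrier» (both stubs ≥ open-in-print, KEY-NS #124 (B)); KEY-NS
#138: (1) the open model-lattice frontier «b < 1.7 via ≥ 3-window certified regions + the general-KP
energy/time-integral ingredient» is ONE certificate factory = LEAD SOC alone; (3) SE takes no
structural hour until the W5 word, after which its LEAD lends one pair of hands to LEAD SOC's named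
piece (`--supports 27057`); (4) kernel facts of record: aside-adjacent 24644 `DyadicBreakBelowOne`
proved on [7/10, 1] by p626568 and on [13/20, 1] by ow-p1's 2-mode sub-interval certificates
(p629445 at 3/4, p630847 on [3/4,1], p631429 on [13/20,1] — the 2-mode method's floor is b ≈ 1.62),
open below 13/20; 2-window regions die near b ≈ 1.58–1.62. BINDER VET of record (refuter1 g12,
DIRECTOR-NS #212 (2), 2026-08-28 11:41Z, K-118, seconding refuter cf2-ref-g7's stamp note
10:40:38Z): ForwardSourceTailEnvelopeKP PASS-AS-TYPED — C after (R, ε₀, α, S, X₀, η, T) and before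
ν, s, X; literally weaker than the aside 26373; degenerate / KP-chain / BMR-2011 consistency ✓. W5
FINAL: PENDING at this writing (2026-08-28 ≈11:50Z) — run of record kit j304565 at 43/58 rows with
every FINAL column CLEAR-compatible (12-block ≥ 1.257 everywhere; Θ^S(κ>2) ≥ 1.159 on α_SB^leak;
T₁₀^leak = its leak-free control at the chain head, a transient; ε₀ = 1/16 N+20 % column kit j304977
FINAL: Θ^S 1.616–1.646, 12-block 1.659–1.661), three ε₀ = 1/16 N_rec rows wall-cut before t = 30
(excluded by the pre-stated criterion, not by value) and re-running as kit j306164 / j307577 /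
j307578, memo ETA ≈12:30Z (ns-idea-1 g5 11:43Z); the critic's FINAL word («W5 CLEAR (run of record
agrees)» unfreezes 27057's structural hours per KEY-NS #133 (a) / DIRECTOR-NS #204 (6); DISAGREE
keeps the freeze) is recorded on the items as evidence, not in this header.
#3 ForwardSourceSmoothing (crux, stmt-26374, shared) — PROVED 2026-08-28T07:51Z
(`forwardSourceSmoothing_proof`); consumed per table inside `closes`.
#3 NonOrthantBreak (crux, stmt-24640, shared) — DECLARED RESIDUAL #1: sign-mixing tables (the former
mixing half of A⁺; held by the critic 07:05Z). [difficulty: XL]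
#3 NonDiagonalOrthantBreak (crux, stmt-27000, shared) — DECLARED RESIDUAL #2: orthant tables with a
non-diagonal forward feed form (twin pocket); not attacked; plan V⁺ = (⋂ ker A_i)^⊥. [difficulty:
L–XL] (why it might fail: feed forms not simultaneously diagonalisable with kernel-direction energy
recycled into sources at a ν-dependent rate.) [HOME INBOX idea-crit-3 2026-08-28].
ASIDES (settled, never reworded): ForwardSourceTailEnvelope (stmt-26373, all tables: twin embedding;
rev-10 record: refuted MODULO the shared universally-quantified a-priori family
`SideBranchEscapeEstimateAt` —
`forwardSourceTailEnvelope_false_of_sideBranchEscapeEstimateSmallRatio` p627763, after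
p623621/p625866 modulo `SideBranchEscapeSmallRatio`; existence half discharged by the envelope
engine; the four dead statements 25507/26608/26373/26128 of the cluster now rest on that ONE
estimate family), ViscousTailEnvelope A‴ (26128), EnvelopeSmoothing B‴ (26132), TailEnergyEnvelope A
(23973, refuted modulo GatedCriticalFronts p591070), 24008, 23906, 23907.

KILL CRITERIA. A⁺_KP: a KP network family (orthant, diagonal feeds, fixed spread R) and a fixed
window T on which sup_ν of the forward-source partial tails decays no faster than (1+ε₀)^(−n) (Θ⁺(n)
≤ 1 on a band growing as ν ↓) at arbitrarily small ε₀ refutes ForwardSourceTailEnvelopeKP (close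
--reason refuted:ForwardSourceTailEnvelopeKP). FIRED AND RECORDED, not re-litigated: total-energy
envelopes (T₁₀/α_SB pockets) and the all-tables syntactic-S⁺ envelope 26373 (twin embedding). A
kernel proof that some sign-mixing or non-diagonal orthant table of E₂(R) cascades at arbitrarily
small ε₀ refutes a residual and with it the rung target itself. Superseded if SubOnsagerCeiling
(27057) or OrthantWake (26999) closes first on the KP class.

NOT DECOMPOSED YET. εs(R) (expected ≲ c/R²) and η(R, ε₀, α, X₀); whether S can always be taken =
S⁺(α) exactly (expected yes); the ν-uniform crossover bump for sign-mixing tables; the orthant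
supplier (forward-source OrthantTailCeiling) is a sibling-route repair, not filed here; the slaving
lemma of B⁺ as a separate support once a prover scopes it.

CHEAPEST FALSIFIER. ONE batched kit job with num/kp_lattice.py (Θ⁺ column; lid-safe band via
num/analyze_blocks.py): dumbbell, symmetric/asymmetric 2-cycles and T₁₀ at ε₀ ∈ {1/32, 1/64, 1/128}
× ν ∈ {1e-8, 1e-10}, N doubled once: kill = Θ⁺(n) ≤ 1 beyond κ 2 on a band growing as ν ↓. Rows on
record: kit j302483/j302646 (38), j303295 (49 random KP networks, min Θ⁺ 1.038), j303489/j303958 (26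
cycle rows, min Θ⁺ 1.008), j303108 (ε₀ = 1/64, running at filing).

NUMBERS. Critical slope (1+ε₀)^(−n); K41 flow-through slope (1+ε₀)^(−5n/3); exit-complete class W ∈
[1.204, 1.9] (j299186, census C.1); dead-end pocket: W_total ≈ c/ε₀ for a chain-fed pocket F(0→1′)c,
W_total ≈ 0.4 ε₀-independent for the compound T₁₀ (census C.2–C.3); BMR invariant region at ratio 2:
margin 2ε; crossover shell n_ν ≈ log(1/ν)/(2 log(1+ε₀)).

DEFINITION REQUESTS. None: S⁺(α) is inlined as the hypothesis `∀ i ∉ S, ∀ j l, α i j l (0,0,1) = 0`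
on a `Finset (Fin 4)`; all other constants exist (`quadTerm`, `InTableClass`, `ViscousGlobal`,
`ViscousStall`, `noRobustBlowupBelow_of_viscousStall`).

Novelty: Searches (2026-08-28): rg over the sub's Theses for ViscousStall / hasGlobal_of_viscousGlobal / BMR
(hits only as remarks: TaoLadderRungTwoBreak l.97 "(ρ+) m = 1 prototype", no route uses
`ViscousStall`); `ledger negatives --problem NavierStokesRegularity` (no entry on ViscousStall /
envelopes); lit search "dyadic model inviscid blow-up Katz Pavlovic Cheskidov Friedlander" (8 local:
arxiv-math_0601074, arxiv-0811.1689, arxiv-1406.2423, arxiv-1705.01456, arxiv-2605.13827 …;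
crossref: doi:10.1090/proc/12494 Cheskidov–Zaya 2015); lit search --hybrid "shell model blow-up
self-similar anomalous scaling exponent Dombre Gilson" (books only: frisch1995 p.132); held
[corpus:paper:arxiv-1210.2494 p.3, p.9–10] (Mailybaev 2013, renormalised blow-up attractors).
Nearest prior art found: BarbatoMorandinRomito2011 Thm 1 / tree
`not_noGlobalCascade_one_dyadicTable` (the architecture for ONE table, m = 1, ε₀ = 1,
positivity-based); doi:10.1090/proc/12494 (Cheskidov–Zaya: forward cascade regularises the dyadic
model); nearest route: TaoLadderRungTwoBreak item NoLoudLadderOne (stmt-20452, the (ρ+) exclusion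
INSIDE the eternal-solution architecture).
Delta: the first route that decides the rung forward in time through the tree's unused
`ViscousStall` normal form, replacing BMR's positivity/invariant region by a sign-free tail-energy
ENVELOPE with a subcritical margin uniform over E₂(R) at small ε₀ — no eternal solutions, no
extraction, K2ᵛ/N-39 off the path.
Claimed grade: new-combination  [refs: 10.1090/proc/12494, arxiv-math_0601074, arxiv-0811.1689, arxiv-1406.2423, arxiv-1705.01456, arxiv-2605.13827, doi:10.1090/proc/12494, paper:arxiv-1210.2494, BarbatoMorandinRomito2011]

Barriers (technique_class: energy-envelope, dissipation-bootstrap, shell-model): - technique_class: energy-envelope, dissipation-bootstrap, shell-model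
- Literature.Barriers.NavierStokesRegularity.DyadicCascadeRegularity: consistent — it is the m = 1
engine of this line (BMR 2011), not an obstruction; the line generalises its conclusion sign-free.
- Literature.Barriers.NavierStokesRegularity.TaoAveragedBlowup: outside — Tao's blow-up uses tables
whose spread grows as ε₀ ↓ 0; crux A only speaks below εs(R) at FIXED spread, so it requires (and
bets, with the host rung) that no spread-uniform family exists; εs(R) ≲ c/R² is consistent with
every construction in the tree.
- Literature.Barriers.NavierStokesRegularity.HyperdissipativeAveragedBlowup: outside for the same
reason — Coiculescu's Thm 4.2 gives blow-up for every λ ∈ (1,2) with λ-dependent operators; a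
λ-UNIFORM-spread version would refute crux A and the rung together (named kill).
- Literature.Barriers.NavierStokesRegularity.TruncatedDyadicBlowup: outside — the exogenously
truncated model is not an autonomous comparable table; it is the picture of the enemy (perfect
pairwise transfer) that crux A says autonomous fixed-spread tables cannot realise at small ε₀.
- Literature.Barriers.NavierStokesRegularity.NearOneDssTypeIExclusion: not applicable (PDE-side DSS
profiles at λ ↓ 1; this line has no self-similar objects).
- theory-2 N-39 (non-periodicity of extracted eternal solutions): evaded by construction — no
eternal solutions, no extraction.
- Negatives index: no refuted statement of the summit concern

History (route lifecycle, newest last):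
- 2026-08-28T00:09:10Z · rev 1: restated SubcriticalTailEnvelope (stmt-NavierStokesRegularity-23904) — rev 1: restate crux A window-wise (∀T ∃C) per critic P1 — strictly weaker, same glue; instrument j294445+j294541 silent (wake floor) (planner-ns-idea-1-g2-0)
- 2026-08-28T00:09:43Z · rev 1: restated SubcriticalTailEnvelope (stmt-NavierStokesRegularity-23904) — rev 1: restate crux A window-wise (∀T ∃C) per critic P1 — strictly weaker, same glue; instrument j294445+j294541 silent (wake floor) (planner-ns-idea-1-g2-0)
- 2026-08-28T00:15:32Z · rev 2: restated EnvelopeSmoothing (stmt-NavierStokesRegularity-23905) — rev 2: restate crux B to take the window-wise envelope hypothesis matching rev-1 A (critic P1); glue StallOfEnvelope/closes unchanged and re-provable (SketchR1. (planner-ns-idea-1-g2-0)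
- 2026-09-04T06:19:35Z · DORMANT — reconciler: no traction for 5 d (last activity statement-checked at 2026-08-30T05:36:41Z); parked, not closed — `ledger route dormant route-NavierStokesRegulari (operator:999:934175)

sub-problem: NavierStokesRegularity · status: dormant · opened planner-ns-idea-1-g2-0 2026-08-27T23:57:37Z · rev 10 · ledger route-NavierStokesRegularity-SubcriticalEnvelope
GENERATED by the gate from the ledger (D-0016/17). Provers cite these decls: `theorem foo : Summit.NavierStokesRegularity.NavierStokesRegularity.Theses.SubcriticalEnvelope.<Decl> := …` in Summits/NavierStokesRegularity/NavierStokesRegularity/Theorems/<Name>.lean.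
-/

namespace Summit.NavierStokesRegularity.NavierStokesRegularity.Theses.SubcriticalEnvelope

open scoped BigOperators Topology Manifold Classical MeasureTheory ProbabilityTheory Matrix InnerProductSpace ComplexConjugate ContinuousMap
open Filter Set Function TopologicalSpace MeasureTheory

attribute [summit_statement] _root_.NavierStokesRegularity
attribute [summit_statement] _root_.Summit.NavierStokesRegularity.NavierStokesRegularity.Theses.TaoLadderRungTwoBreak.Target

open Literature.NS

/-- item stmt-NavierStokesRegularity-27130 · crux · rank 2 · open · by planner
why it might fail: KP network whose sources keep ν-uniformly critical standing energy behind the front inside a fixed window: capacitor re-entry at an ε₀-small rate, or the dumbbell-type block exponent W(ε₀) → 1 as ε₀ → 0 (1.233 at 1/8, 1.266 at 1/16; 1/64 pending kit j303108).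
sources: Tao2016AveragedNS, BarbatoMorandinRomito2011, arXiv:1310.7612, doi:10.1090/proc/12494, CENSUS-24639-v3, kit:j302483
[crux] KP FORWARD-SOURCE TAIL ENVELOPE, ν-UNIFORM (A⁺_KP, rev 8 = A⁺ stmt-26373 restricted to KP
NETWORKS PROPER; 26373 is DEAD AS TYPED by the TWIN-EMBEDDING witness of idea-crit-3 / ns-ow-p1 g4,
2026-08-28 ≈08:25Z, exact algebra: the all-tables statement contains the orthant table of E₂(17)
obtained from α_SB by splitting the pocket feed into twins x_1² → x_2′ (3/25), x_1² → x_3′ (4/25)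
plus the differential feed (4x_2 − 3x_3)²/16 → x_0′ (cross coefficient −3/4); X̃ = (X_0, X_1,
(3/5)X_2, (4/5)X_2) embeds every α_SB solution, every mode is a SYNTACTIC forward source, S = univ
is forced and T⁺ ≡ T_total(α_SB) with Θ → 5/9 < 1 on the ν-growing band after the inviscid front
time — so for T beyond it no ν-uniform C exists; 26373 stays in the file as that settled negative,
never reworded). A⁺_KP keeps everything of 26373 — εs after R; S ⊇ S⁺(α) after α; η after X₀;
window-wise constants ∀ T ∃ C BEFORE ν; honest regular ν-viscous solutions; partial sums — and
restricts the CLASS to orthant tables (sign condition of OrthantWake) with DIAGONAL forward feed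
forms «∀ a b i, a ≠ b → α a b i (0,0,1) = 0» (every syntactic source x_a has the live self-draining
term α_(aai)Λx_a²; all 87 + 61 + -/
@[route_item "route-NavierStokesRegularity-SubcriticalEnvelope"]
def ForwardSourceTailEnvelopeKP : Prop :=
  ∀ R : ℝ, 1 ≤ R → ∃ εs : ℝ, 0 < εs ∧ ∀ ε₀ : ℝ, 0 < ε₀ → ε₀ ≤ εs → ∀ α : Fin 4 → Fin 4 → Fin 4 → ℤ × ℤ × ℤ → ℝ, Literature.Analysis.FluidPDE.TaoCascade.InTableClass R α → (∀ (Y : Fin 4 → ℤ → ℝ → ℝ) (τ : ℝ), (∀ (j : Fin 4) (k : ℤ), 1 ≤ k → 0 ≤ Y j k τ) → ∀ δ : ℝ, 0 < δ → ∀ (i : Fin 4) (n : ℤ), 1 ≤ n → Y i n τ = 0 → 0 ≤ Literature.Analysis.FluidPDE.TaoCascade.quadTerm δ α Y i n τ) → (∀ a b i : Fin 4, a ≠ b → α a b i (0, 0, 1) = 0) → ∃ S : Finset (Fin 4), (∀ i, i ∉ S → ∀ j l : Fin 4, α i j l (0, 0, 1) = 0) ∧ ∀ X₀ : Fin 4 →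 ℝ, ∃ η : ℝ, 0 < η ∧ ∀ T : ℝ, 0 < T → ∃ C : ℝ, ∀ ν : ℝ, 0 < ν → ∀ s ∈ Set.Ioc (0 : ℝ) T, ∀ X : Fin 4 → ℤ → ℝ → ℝ, (∀ i k, X i k 0 = if k = 0 then X₀ i else 0) → (∀ i k, k < 0 → ∀ t, X i k t = 0) → (∃ M : ℝ, ∀ (t : ℝ) (i : Fin 4) (k : ℤ), (1 + (1 + ε₀) ^ ((10 : ℝ) * k)) * |X i k t| ≤ M) → (∀ i k, Continuous (X i k)) → (∀ i k, ∀ t ∈ Set.Icc (0 : ℝ) s, HasDerivWithinAt (X i k) (Literature.Analysis.FluidPDE.TaoCascade.quadTerm ε₀ α X i k t - ν * (1 + ε₀) ^ ((2 : ℝ) * k) * X i k t) (Set.Icc 0 s) t) → ∀ n N : ℕ, n ≤ N → ∀ t ∈ Set.Icc (0 : ℝ) s, ∑ k ∈ Finset.Icc n N, ∑ i ∈ S, (1 / 2) * X i (k : ℤ) t ^ 2 ≤ C * (1 + ε₀) ^ (-((1 + η) * (n : ℝ)))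

/-- item stmt-NavierStokesRegularity-24640 · crux · rank 3 · open · by planner
why it might fail: Sign-mixing tables: parametric pocket discharge / backscatter pile-up at the crossover, or a genuine small-ε₀ robust cascade (Tao-type gates surviving ε₀ → 0), which would refute the rung itself.
sources: Tao2016AveragedNS, CENSUS-24639-v3
[crux] RESIDUAL CONJUNCT (declared): for every R ≥ 1 there is εR > 0 such that for ε₀ ≤ εR every
NON-orthant table α ∈ E₂(R) and every one-shell datum admit global pseudo-solutions
(¬NoGlobalCascade ε₀ α X₀). Not attacked by this line (it is the complement of the orthant conjunct;
the lines WakeRatchet / SubcriticalEnvelope / LatticeTransitLiouville / TransitMassLedger bear on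
it). [difficulty: XL] -/
@[route_item "route-NavierStokesRegularity-SubcriticalEnvelope"]
def NonOrthantBreak : Prop :=
  ∀ R : ℝ, 1 ≤ R → ∃ εR : ℝ, 0 < εR ∧ ∀ ε₀ : ℝ, 0 < ε₀ → ε₀ ≤ εR → ∀ (α : Fin 4 → Fin 4 → Fin 4 → ℤ × ℤ × ℤ → ℝ) (X₀ : Fin 4 → ℝ), Literature.Analysis.FluidPDE.TaoCascade.InTableClass R α → ¬ (∀ (Y : Fin 4 → ℤ → ℝ → ℝ) (τ : ℝ), (∀ (j : Fin 4) (k : ℤ), 1 ≤ k → 0 ≤ Y j k τ) → ∀ δ : ℝ, 0 < δ → ∀ (i : Fin 4) (n : ℤ), 1 ≤ n → Y i n τ = 0 → 0 ≤ Literature.Analysis.FluidPDE.TaoCascade.quadTerm δ α Y i n τ) → ¬ Literature.Analysis.FluidPDE.TaoCascade.NoGlobalCascade ε₀ α X₀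

/-- item stmt-NavierStokesRegularity-26374 · crux · rank 3 · closed · proved by Summit.NavierStokesRegularity.NavierStokesRegularity.Theorems.forwardSourceSmoothing_proof (prover) · by planner
why it might fail: Slaving of non-source modes needs every power term into them to carry a source amplitude or a source pair below (rotor identity, (4.2)–(4.3), Tao's shift set) plus ⌈1/η⌉ catalyst passes lifting their decay exponent above 1/2; a missed coupling type or a non-summable energy identity breaks it.
sources: Tao2016AveragedNS, BarbatoMorandinRomito2011, Literature:exists_viscousGlobal_of_subcriticalEnvelope_of_inTableClass, Literature:viscous_bootstrap_step
[crux] FORWARD-SOURCE ENVELOPE SMOOTHING (fixed ν, constants free; rank 3 — a real extension of the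
landed engine, not a citation). If S contains every forward source of α ∈ E₂(R) (i ∉ S ⇒ α i j l
(0,0,1) = 0) and on every window [0,T] the S-mode partial tail energies of all regular ν-viscous
solutions on sub-windows [0,s] obey a subcritical envelope C(T)(1+ε₀)^{−(1+η)n}, then a GLOBAL
regular solution of the ν-viscous lattice exists (`ViscousGlobal ε₀ ν α X₀ X`). The landed engine
`exists_viscousGlobal_of_subcriticalEnvelope` (p593260; bootstrap `viscous_bootstrap_step` γ ↦ 2γ −
1/2 from any γ > 1/2, continuation `exists_viscousGlobal_of_apriori_bound`) needs the envelope on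
ALL modes; the new step is the SLAVING of the non-source modes D = Sᶜ: per shell k ≥ 1 they start
empty, receive (0,0,1)-injection only from PAIRS of sources at shell k−1 (α a b d (0,0,1) ≠ 0 forces
a, b ∈ S by (4.2)), exchange energy with same-shell sources only through terms carrying a source
amplitude (in-shell triads) or through rotors catalysed by a shell-(k+1) amplitude whose partner is
a source (two-shell triads with vanishing (0,0,1) coefficient are rotors inside the lower shell by
(4.2)–(4.3)), and ar -/
@[route_item "route-NavierStokesRegularity-SubcriticalEnvelope"]
def ForwardSourceSmoothing : Prop :=
  ∀ (ε₀ η R : ℝ), 0 < ε₀ → 0 < η → ∀ α : Fin 4 → Fin 4 → Fin 4 → ℤ × ℤ × ℤ → ℝ, Literature.Analysis.FluidPDE.TaoCascade.InTableClass R α → ∀ S : Finset (Fin 4), (∀ i, i ∉ S → ∀ j l : Fin 4, α i j l (0, 0, 1) = 0) → ∀ (X₀ : Fin 4 → ℝ) (ν : ℝ), 0 < ν → (∀ T : ℝ, 0 < T → ∃ C : ℝ, ∀ s ∈ Set.Ioc (0 : ℝ) T, ∀ X : Fin 4 → ℤ → ℝ → ℝ, (∀ i k, X i k 0 = if k = 0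 then X₀ i else 0) → (∀ i k, k < 0 → ∀ t, X i k t = 0) → (∃ M : ℝ, ∀ (t : ℝ) (i : Fin 4) (k : ℤ), (1 + (1 + ε₀) ^ ((10 : ℝ) * k)) * |X i k t| ≤ M) → (∀ i k, Continuous (X i k)) → (∀ i k, ∀ t ∈ Set.Icc (0 : ℝ) s, HasDerivWithinAt (X i k) (Literature.Analysis.FluidPDE.TaoCascade.quadTerm ε₀ α X i k t - ν * (1 + ε₀) ^ ((2 : ℝ) * k) * X i k t) (Set.Icc 0 s) t) → ∀ n N : ℕ, n ≤ N → ∀ t ∈ Set.Icc (0 : ℝ) s, ∑ k ∈ Finset.Icc n N, ∑ i ∈ S, (1 / 2) * X i (k : ℤ) t ^ 2 ≤ C * (1 + ε₀) ^ (-((1 + η) * (n : ℝ)))) → ∃ X : Fin 4 → ℤ → ℝ → ℝ, Literature.Analysis.FluidPDE.TaoCascade.ViscousGlobal ε₀ ν α X₀ X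

/-- `ForwardSourceSmoothing` holds: proved by `Summit.NavierStokesRegularity.NavierStokesRegularity.Theorems.forwardSourceSmoothing_proof`. -/
theorem ForwardSourceSmoothing_holds : ForwardSourceSmoothing := _root_.Summit.NavierStokesRegularity.NavierStokesRegularity.Theorems.forwardSourceSmoothing_proof

/-- item stmt-NavierStokesRegularity-27000 · crux · rank 3 · open · by planner
why it might fail: Feed forms not simultaneously diagonalisable: kernel-direction energy recycled into sources at a ν-dependent rate; or small-ε₀ global existence genuinely fails on some non-diagonal orthant table (would refute the rung itself).
sources: HOME INBOX idea-crit-3 2026-08-28T08:25Z twin embedding, Tao2016AveragedNS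
[crux] DECLARED RESIDUAL #2 (rank 3; not attacked by this line, exempt like NonOrthantBreak
stmt-24640): the NON-DIAGONAL ORTHANT POCKET — ∀ R ≥ 1 ∃ εR > 0 ∀ ε₀ ≤ εR ∀ α ∈ E₂(R) orthant whose
forward feed forms are NOT all diagonal (some α a b i (0,0,1) ≠ 0 with a ≠ b) ∀ X₀, ¬NoGlobalCascade
ε₀ α X₀. This is exactly the pocket exhibited by the twin-embedding witness (idea-crit-3 / ns-ow-p1
g4, 2026-08-28): a dead-end pocket table (α_SB, T₁₀) rotated in a mode plane so that the parked
direction is the null direction of a rank-one feed form (4x_2 − 3x_3)²/16; on it every syntactic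
forward-source functional equals the total tail energy and inherits the total-tail refutations (Θ →
5/9, W = 0.20–0.47). Why it is a thin pocket and what would attack it: for ORTHANT tables each
forward feed form A_i (matrix a,b ↦ α a b i (0,0,1)) is a symmetric Z-matrix that is copositive,
hence positive semidefinite, so a shell configuration carries zero forward flux iff it lies in the
common kernel N(α) = ⋂_i ker A_i; the basis-free source space V⁺(α) = N(α)^⊥ (projection P) in place
of the coordinate set S⁺ defeats every rotated-pocket disguise (for the twin table V⁺ = span{e_0,
e_1, 4e_2 − 3e_3} and T^ -/
@[route_item "route-NavierStokesRegularity-SubcriticalEnvelope"]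
def NonDiagonalOrthantBreak : Prop :=
  ∀ R : ℝ, 1 ≤ R → ∃ εR : ℝ, 0 < εR ∧ ∀ ε₀ : ℝ, 0 < ε₀ → ε₀ ≤ εR → ∀ (α : Fin 4 → Fin 4 → Fin 4 → ℤ × ℤ × ℤ → ℝ) (X₀ : Fin 4 → ℝ), Literature.Analysis.FluidPDE.TaoCascade.InTableClass R α → (∀ (Y : Fin 4 → ℤ → ℝ → ℝ) (τ : ℝ), (∀ (j : Fin 4) (k : ℤ), 1 ≤ k → 0 ≤ Y j k τ) → ∀ δ : ℝ, 0 < δ → ∀ (i : Fin 4) (n : ℤ), 1 ≤ n → Y i n τ = 0 → 0 ≤ Literature.Analysis.FluidPDE.TaoCascade.quadTerm δ α Y i n τ) → ¬ (∀ a b i : Fin 4, a ≠ b → α a b i (0, 0, 1) = 0) → ¬ Literature.Analysis.FluidPDE.TaoCascade.NoGlobalCascade ε₀ α X₀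

-- earlier SubcriticalTailEnvelope (stmt-NavierStokesRegularity-23904, replaced 2026-08-28T00:09:43Z -> stmt-NavierStokesRegularity-23973): retired by None — ∀ R : ℝ, 1 ≤ R → ∃ η εs : ℝ, 0 < η ∧ 0 < εs ∧ ∀ ε₀ : ℝ, 0 < ε₀ → ε₀ ≤ εs → ∀ α : Fin 4 → Fin 4 → Fin 4 → ℤ × ℤ × ℤ → ℝ, Literature.Analysis.FluidPDE.TaoCascade.InTableClass R α → ∀ (X₀ : Fin 4 → ℝ) (K₁ : ℝ), 0 ≤ K₁ → ∃ C : ℝ, ∀ T : ℝ, 0 < T → ∀ 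
/-- item stmt-NavierStokesRegularity-23973 · aside · rank 2 · open · by planner
why it might fail: a fixed-spread table whose pulses become reflectionless under some ADVERSARIAL sub-dissipative perturbation (damping the wake modes cleans the transit) at arbitrarily small ε₀; or a spread-uniform version of Coiculescu's λ∈(1,2) cascades; cascade fronts with exponent drifting to y ≤ (1+η)/5.
sources: Tao2016AveragedNS, BarbatoMorandinRomito2011, arXiv:2307.15986, kit:j294541
[crux] SUBCRITICAL TAIL ENVELOPE, WINDOW-WISE (rev 1, critic idea-crit-3 P1 00:05Z): for every R ≥ 1
there are η, εs > 0 such that for ε₀ ≤ εs, every table in E₂(R), one-shell datum, defect level K₁ ≥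
0 AND EVERY WINDOW [0,T] there is C = C(…,T) bounding the tail energy of every
(K₁,0)-pseudo-solution on [0,T] by C(1+ε₀)^(−(1+η)n). Strictly weaker than rev 0 (∃C ∀T):
infinite-time slow coherent transport is no longer excluded; the content sits at K₁ > 0 (all
dissipative perturbations), uniformly over the perturbation. -/
@[route_item "route-NavierStokesRegularity-SubcriticalEnvelope"]
def SubcriticalTailEnvelope : Prop :=
  ∀ R : ℝ, 1 ≤ R → ∃ η εs : ℝ, 0 < η ∧ 0 < εs ∧ ∀ ε₀ : ℝ, 0 < ε₀ → ε₀ ≤ εs → ∀ α : Fin 4 → Fin 4 → Fin 4 → ℤ × ℤ × ℤ → ℝ, Literature.Analysis.FluidPDE.TaoCascade.InTableClass R α → ∀ (X₀ : Fin 4 → ℝ) (K₁ : ℝ), 0 ≤ K₁ → ∀ T : ℝ, 0 < T → ∃ C : ℝ, ∀ X E : Fin 4 → ℤ → ℝ → ℝ, Literature.Analysis.FluidPDE.TaoCascade.CascadeODESolutionOn T ε₀ α K₁ 0 0 X₀ X E → ∀ n N : ℕ, n ≤ N → ∀ t ∈ Set.Icc (0 : ℝ) T, ∑ k ∈ Finset.Icc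 n N, ∑ i, E i (k : ℤ) t ≤ C * (1 + ε₀) ^ (-((1 + η) * (n : ℝ)))

/-- item stmt-NavierStokesRegularity-26128 · aside · rank 2 · open · by planner
why it might fail: ν-uniformity may fail: the bottleneck bump at the dissipation-crossover shell may be unbounded in ν on sign-mixing tables (backscatter pile-up), or a fixed-spread sign-mixing table carries a front with weighted exponent W ≤ 1 for ε₀ ∈ [1/16,1/4] (class min W = 1.204 at 1/8, kit j299186).
sources: Tao2016AveragedNS, BarbatoMorandinRomito2011, arXiv:1310.7612, doi:10.1090/proc/12494, arXiv:1402.0290, kit:j294541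
[crux] VISCOUS-FAMILY SUBCRITICAL TAIL ENVELOPE (REAL rank-2 repair of SubcriticalTailEnvelope
stmt-23973, KEY-NS #16 (A)(ii); 23973 stays in the file as the settled negative edge
`subcriticalTailEnvelope_false_of_gatedCriticalFronts`, p591070). For every spread R ≥ 1 there is
εs(R) > 0 such that for every scale ratio 1+ε₀ with ε₀ ≤ εs, every comparable table α ∈ E₂(R)
(`InTableClass R α`: orthant AND sign-mixing) and every one-shell datum X₀ there is a margin η > 0
with: for every window T there is ONE constant C, UNIFORM OVER ALL VISCOSITIES ν > 0, such that
every honest NS-damped lattice solution X on [0,s], s ≤ T (exact quadratic transfer `quadTerm` minus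
ν(1+ε₀)^(2k)X_k; zero below the datum shell, (4.5)-weighted-bounded, continuous) has tail energy
Σ_{k=n..N} Σ_i ½X_{i,k}(t)² ≤ C(1+ε₀)^(−(1+η)n) for all n ≤ N, t ≤ s. The quantifier order ∃η ∀T ∃C
∀ν is the content: with C after ν it is global viscous existence reworded (`viscousFlow_unique` +
`ViscousGlobal.apriori`), with C before T it is the refuted-adjacent rev-0 shape. Only the VISCOUS
FAMILY is quantified (the (K₁,0)-pseudo-solution class of 23973 is dead: gated sub-dissipative
damping steers fronts to exactly critical, -/
@[route_item "route-NavierStokesRegularity-SubcriticalEnvelope"]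
def ViscousTailEnvelope : Prop :=
  ∀ R : ℝ, 1 ≤ R → ∃ εs : ℝ, 0 < εs ∧ ∀ ε₀ : ℝ, 0 < ε₀ → ε₀ ≤ εs → ∀ α : Fin 4 → Fin 4 → Fin 4 → ℤ × ℤ × ℤ → ℝ, Literature.Analysis.FluidPDE.TaoCascade.InTableClass R α → ∀ X₀ : Fin 4 → ℝ, ∃ η : ℝ, 0 < η ∧ ∀ T : ℝ, 0 < T → ∃ C : ℝ, ∀ ν : ℝ, 0 < ν → ∀ s ∈ Set.Ioc (0 : ℝ) T, ∀ X : Fin 4 → ℤ → ℝ → ℝ, (∀ i k, X i k 0 = if k = 0 then X₀ i else 0) → (∀ i k, k < 0 → ∀ t, X i k t = 0) → (∃ M : ℝ, ∀ (t : ℝ) (i : Fin 4) (k : ℤ), (1 + (1 + ε₀) ^ ((10 : ℝ) * k)) * |X i k t| ≤ M) → (∀ i k, Continuous (X i k)) → (∀ i k, ∀ t ∈ Set.Icc (0 : ℝ) s, HasDerivWithinAt (X i k) (Literature.Analysis.FluidPDE.TaoCascade.quadTerm ε₀ α X i k t - ν * (1 + ε₀) ^ ((2 : ℝ) * k) * X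 i k t) (Set.Icc 0 s) t) → ∀ n N : ℕ, n ≤ N → ∀ t ∈ Set.Icc (0 : ℝ) s, ∑ k ∈ Finset.Icc n N, ∑ i, (1 / 2) * X i (k : ℤ) t ^ 2 ≤ C * (1 + ε₀) ^ (-((1 + η) * (n : ℝ)))

/-- item stmt-NavierStokesRegularity-26373 · aside · rank 2 · open · by planner
why it might fail: A source mode may keep ν-uniformly supercritical standing energy behind the front (capacitor pocket with weak exit 1/R at small ε₀; in-shell rotor refilling a source), or on sign-mixing tables pocket discharge / crossover pile-up forces C(ν) → ∞. Kill: W⁺ < 1 on bands growing as ν ↓.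
sources: Tao2016AveragedNS, BarbatoMorandinRomito2011, arXiv:1310.7612, doi:10.1090/proc/12494, CENSUS-24639-v3, kit:j294541
[crux] FORWARD-SOURCE TAIL ENVELOPE, ν-UNIFORM (LINE g5-2 «monotone quantity hunt»: the functional
changes, not the constants). Reaction to CENSUS-24639-v3 (ns-ow-p1 g2, 2026-08-28): on the dead-end
side-pocket ORTHANT table T₁₀ ∈ E₂(10) every envelope/ratchet of the TOTAL tail energy Σ_{k≥n}Σ_i
E_{i,k} with constants chosen before ν is numerically supercritical (per-hop exponent W = 0.20–0.47
for ε₀ = 1/8 … 1/64, W·ε₀ ∝ ε₀, band = whole inertial window growing as ν ↓), because diode-fed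
dead-end modes PARK a fixed fraction of the passing energy per unit κ = nε₀ at every shell behind
the front; this kills OrthantHopWake 24639 as typed, predicts OrthantTailCeiling 25507
refuted-misstated, and makes ViscousTailEnvelope 26128 (A‴) false-in-waiting on orthant tables for
every εs. Parked energy is dynamically inert for the cascade: the only terms of `quadTerm` driving
shell n from strictly lower shells are the μ = (0,0,1) terms, whose sources are the FORWARD SOURCES
S⁺(α) = {i : ∃ j l, α i j l (0,0,1) ≠ 0}; a two-shell triad whose (0,0,1) coefficient vanishes is,
by (4.2)–(4.3), a rotor inside the lower shell catalysed by the upper mode and moves no energy up.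
STATEMENT: for every sprea -/
@[route_item "route-NavierStokesRegularity-SubcriticalEnvelope"]
def ForwardSourceTailEnvelope : Prop :=
  ∀ R : ℝ, 1 ≤ R → ∃ εs : ℝ, 0 < εs ∧ ∀ ε₀ : ℝ, 0 < ε₀ → ε₀ ≤ εs → ∀ α : Fin 4 → Fin 4 → Fin 4 → ℤ × ℤ × ℤ → ℝ, Literature.Analysis.FluidPDE.TaoCascade.InTableClass R α → ∃ S : Finset (Fin 4), (∀ i, i ∉ S → ∀ j l : Fin 4, α i j l (0, 0, 1) = 0) ∧ ∀ X₀ : Fin 4 → ℝ, ∃ η : ℝ, 0 < η ∧ ∀ T : ℝ, 0 < T → ∃ C : ℝ, ∀ ν : ℝ, 0 < ν → ∀ s ∈ Set.Ioc (0 : ℝ) T, ∀ X : Fin 4 → ℤ → ℝ → ℝ, (∀ i k, X i k 0 = if k = 0 then X₀ i else 0) → (∀ i k, k < 0 → ∀ t, X i k t = 0) → (∃ M : ℝ, ∀ (t : ℝ) (i : Fin 4) (k : ℤ), (1 + (1 + ε₀) ^ ((10 : ℝ) * k)) * |X i k t| ≤ M) → (∀ i k, Continuous (X i k)) → (∀ i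 k, ∀ t ∈ Set.Icc (0 : ℝ) s, HasDerivWithinAt (X i k) (Literature.Analysis.FluidPDE.TaoCascade.quadTerm ε₀ α X i k t - ν * (1 + ε₀) ^ ((2 : ℝ) * k) * X i k t) (Set.Icc 0 s) t) → ∀ n N : ℕ, n ≤ N → ∀ t ∈ Set.Icc (0 : ℝ) s, ∑ k ∈ Finset.Icc n N, ∑ i ∈ S, (1 / 2) * X i (k : ℤ) t ^ 2 ≤ C * (1 + ε₀) ^ (-((1 + η) * (n : ℝ)))

-- earlier EnvelopeSmoothing (stmt-NavierStokesRegularity-23905, replaced 2026-08-28T00:15:32Z -> stmt-NavierStokesRegularity-24008): retired by None — ∀ (ε₀ η R : ℝ), 0 < ε₀ → 0 < η → ∀ α : Fin 4 → Fin 4 → Fin 4 → ℤ × ℤ × ℤ → ℝ, Literature.Analysis.FluidPDE.TaoCascade.InTableClass R α → ∀ X₀ : Fin 4 → ℝ, (∀ K₁ : ℝ, 0 ≤ K₁ → ∃ C : ℝ, ∀ T : ℝ, 0 < T → ∀ X E : Fin 4 → ℤ → ℝ → ℝ, Literature.Analysis.Flu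
/-- item stmt-NavierStokesRegularity-24008 · aside · rank 3 · open · by planner
why it might fail: needs local well-posedness + continuation for the DAMPED lattice in the weighted sup-norm space (tree: inviscid only) and a far-tail induction on each [0,T]; the (1+ε₀)^(10n) weight of (4.5) is reached from a geometric envelope only via the double-exponential far tail.
sources: BarbatoMorandinRomito2011, Cheskidov2008, Tao2016AveragedNS
[crux] ENVELOPE SMOOTHING, WINDOW-WISE HYPOTHESIS (rev 2, critic P1): if at scale ratio 1+ε₀ a table
in some E₂(R) and a one-shell datum have, for every defect level K₁ ≥ 0 and EVERY WINDOW [0,T], a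
constant C(T) bounding the tail energy of all (K₁,0)-pseudo-solutions on [0,T] by C(1+ε₀)^(−(1+η)n),
then for every ν > 0 the NS-scaled viscous lattice from that datum is globally regular
(ViscousGlobal): window-by-window continuation — beyond n₁(ν,η,C(T)) dissipation ν(1+ε₀)^(2n)
dominates the transfer rate √C(1+ε₀)^((2−η/2)n), far tail super-geometric, (4.5) finite on [0,T].
BMR 2011 §3.2 bootstrap, sign-free, m = 4. -/
@[route_item "route-NavierStokesRegularity-SubcriticalEnvelope"]
def EnvelopeSmoothing : Prop :=
  ∀ (ε₀ η R : ℝ), 0 < ε₀ → 0 < η → ∀ α : Fin 4 → Fin 4 → Fin 4 → ℤ × ℤ × ℤ → ℝ, Literature.Analysis.FluidPDE.TaoCascade.InTableClass R α → ∀ X₀ : Fin 4 → ℝ, (∀ K₁ : ℝ, 0 ≤ K₁ → ∀ T : ℝ, 0 < T → ∃ C : ℝ, ∀ X E : Fin 4 → ℤ → ℝ → ℝ, Literature.Analysis.FluidPDE.TaoCascade.CascadeODESolutionOn T ε₀ α K₁ 0 0 X₀ X E → ∀ n N : ℕ, n ≤ N → ∀ t ∈ Set.Icc (0 : ℝ)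 T, ∑ k ∈ Finset.Icc n N, ∑ i, E i (k : ℤ) t ≤ C * (1 + ε₀) ^ (-((1 + η) * (n : ℝ)))) → ∀ ν : ℝ, 0 < ν → ∃ X : Fin 4 → ℤ → ℝ → ℝ, Literature.Analysis.FluidPDE.TaoCascade.ViscousGlobal ε₀ ν α X₀ X

/-- item stmt-NavierStokesRegularity-23906 · aside · rank 9 · closed · proved by Summit.NavierStokesRegularity.NavierStokesRegularity.Theorems.subcriticalEnvelope_stallOfEnvelope_proof (prover) · by planner
why it might fail: it cannot (three lines of logic: instantiate A at R, feed its envelope clause to B); filed so that the intermediate X is an item in the cone.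
sources: Tao2016AveragedNS
[support] GLUE (pure logic, proved in the sketch as `uniformViscousStall_of`): the subcritical tail
envelope (A) and envelope smoothing (B) together give uniform viscous stall `ViscousStall R` for
every spread R ≥ 1 (the intermediate X of the thesis, in the cone of `closes`). [deps:
SubcriticalTailEnvelope, EnvelopeSmoothing] [difficulty: S] -/
@[route_item "route-NavierStokesRegularity-SubcriticalEnvelope"]
def StallOfEnvelope : Prop :=
  SubcriticalTailEnvelope → EnvelopeSmoothing → ∀ R : ℝ, 1 ≤ R → Literature.Analysis.FluidPDE.TaoCascade.ViscousStall R

-- `StallOfEnvelope` holds: proved by `Summit.NavierStokesRegularity.NavierStokesRegularity.Theorems.subcriticalEnvelope_stallOfEnvelope_proof` (its module imports this route file, so no `_holds` link can be stated here).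

/-- item stmt-NavierStokesRegularity-26132 · aside · rank 9 · closed · proved by Summit.NavierStokesRegularity.NavierStokesRegularity.Theorems.subcriticalEnvelope_viscousEnvelopeSmoothing_proof (prover) · by planner
[support] VISCOUS ENVELOPE SMOOTHING (repair of EnvelopeSmoothing stmt-24008, vacuous as filed
because its hypothesis quantified the refuted (K₁,0)-pseudo-solution class; 24008 stays in the file
as a settled aside). Statement = VERBATIM the landed theorem
`Summit.NavierStokesRegularity.NavierStokesRegularity.Theorems.SubcriticalEnvelopeEnvelopeSmoothingViscous.envelopeSmoothing_viscousFamily`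
(p593538; Literature engine
`Literature.Analysis.FluidPDE.TaoCascade.exists_viscousGlobal_of_subcriticalEnvelope_of_inTableClass`,
p593260, with damped Picard/continuation p591725/p592033/p592389/p593070): for a comparable table, a
one-shell datum, ε₀ > 0, η > 0 and ν > 0, a window-wise subcritical tail envelope (∀T ∃C over all
honest ν-viscous lattice solutions on [0,s], s ≤ T) yields a global regular viscous solution
`ViscousGlobal ε₀ ν α X₀`. Closes by a one-line citation (folder CiteCheck.lean rc 0); filed so the
smoothing half of the BMR architecture is an item in the cone of `closes` (A‴ → B‴ → ViscousStall →
rung, inline in `closes`). why it might fail: it cannot — already proved in tree. sources: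
BarbatoMorandinRomito2011 §3.2; Tao2016AveragedNS (4.5); tree:Summit.NavierStokesRegularit -/
@[route_item "route-NavierStokesRegularity-SubcriticalEnvelope"]
def ViscousEnvelopeSmoothing : Prop :=
  ∀ (ε₀ η R : ℝ), 0 < ε₀ → 0 < η → ∀ α : Fin 4 → Fin 4 → Fin 4 → ℤ × ℤ × ℤ → ℝ, Literature.Analysis.FluidPDE.TaoCascade.InTableClass R α → ∀ (X₀ : Fin 4 → ℝ) (ν : ℝ), 0 < ν → (∀ T : ℝ, 0 < T → ∃ C : ℝ, ∀ s ∈ Set.Ioc (0 : ℝ) T, ∀ X : Fin 4 → ℤ → ℝ → ℝ, (∀ i k, X i k 0 = if k = 0 then X₀ i else 0) → (∀ i k, k < 0 → ∀ t, X i k t = 0) → (∃ M : ℝ, ∀ (t : ℝ) (i : Fin 4) (k : ℤ), (1 + (1 + ε₀) ^ ((10 : ℝ) * k)) * |X i k t| ≤ M) → (∀ i k, Continuous (X i k)) → (∀ i k, ∀ t ∈ Set.Icc (0 : ℝ) s, HasDerivWithinAt (X i k) (Literature.Analysis.FluidPDE.TaoCascade.quadTerm ε₀ α X i k t - ν * (1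 + ε₀) ^ ((2 : ℝ) * k) * X i k t) (Set.Icc 0 s) t) → ∀ n N : ℕ, n ≤ N → ∀ t ∈ Set.Icc (0 : ℝ) s, ∑ k ∈ Finset.Icc n N, ∑ i, (1 / 2) * X i (k : ℤ) t ^ 2 ≤ C * (1 + ε₀) ^ (-((1 + η) * (n : ℝ)))) → ∃ X : Fin 4 → ℤ → ℝ → ℝ, Literature.Analysis.FluidPDE.TaoCascade.ViscousGlobal ε₀ ν α X₀ X

-- `ViscousEnvelopeSmoothing` holds: proved by `Summit.NavierStokesRegularity.NavierStokesRegularity.Theorems.subcriticalEnvelope_viscousEnvelopeSmoothing_proof` (its module imports this route file, so no `_holds` link can be stated here).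

/-- item stmt-NavierStokesRegularity-23907 · assembly · rank 1 · closed · proved by Summit.NavierStokesRegularity.NavierStokesRegularity.Theorems.subcriticalEnvelope_assembly_proof (prover) · by planner
sources: Tao2016AveragedNS
[assembly] SubcriticalTailEnvelope → EnvelopeSmoothing → rung TL-M2Break (Target of
TaoLadderRungTwoBreak), through StallOfEnvelope and the tree theorem
`noRobustBlowupBelow_of_viscousStall`. -/
@[route_item "route-NavierStokesRegularity-SubcriticalEnvelope"]
def Assembly : Prop :=
  SubcriticalTailEnvelope → EnvelopeSmoothing → Summit.NavierStokesRegularity.NavierStokesRegularity.Theses.TaoLadderRungTwoBreak.Target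

-- `Assembly` holds: proved by `Summit.NavierStokesRegularity.NavierStokesRegularity.Theorems.subcriticalEnvelope_assembly_proof` (its module imports this route file, so no `_holds` link can be stated here).

/-! D-0027 §2.1 — DECIDING THEOREM (planner-authored via `route open/edit --closes-file`; by planner-ns-idea-1-g5-0 2026-08-28T09:07:03Z):
its hypotheses are this route's items and its conclusion the registered leaf `Summit.NavierStokesRegularity.NavierStokesRegularity.Theses.TaoLadderRungTwoBreak.Target` (rung TL-M2Break, D-0061) (glue_lint), and it elaborates with this file. -/

@[closes "route-NavierStokesRegularity-SubcriticalEnvelope"] theorem closes (h1 : ForwardSourceTailEnvelopeKP) (hB : ForwardSourceSmoothing)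
    (h5 : NonDiagonalOrthantBreak) (h4 : NonOrthantBreak) :
    Summit.NavierStokesRegularity.NavierStokesRegularity.Theses.TaoLadderRungTwoBreak.Target := by
  intro R hR
  obtain ⟨ε₁, hε₁, H1⟩ := h1 R hR
  obtain ⟨ε₃, hε₃, H3⟩ := h5 R hR
  obtain ⟨ε₂, hε₂, H2⟩ := h4 R hR
  refine ⟨min ε₁ (min ε₃ ε₂), lt_min hε₁ (lt_min hε₃ hε₂), ?_⟩
  intro ε₀ h0 hle α X₀ hα
  by_cases hO : (∀ (Y : Fin 4 → ℤ → ℝ → ℝ) (τ : ℝ), (∀ (j : Fin 4) (k : ℤ), 1 ≤ k → 0 ≤ Y j k τ) → ∀ δ : ℝ, 0 < δ → ∀ (i : Fin 4) (n : ℤ), 1 ≤ n → Y i n τ = 0 → 0 ≤ Literature.Analysis.FluidPDE.TaoCascade.quadTerm δ α Y i n τ)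
  · by_cases hD : (∀ a b i : Fin 4, a ≠ b → α a b i (0, 0, 1) = 0)
    · -- KP table: window envelope (A⁺_KP) + smoothing (B⁺) ⇒ global viscous solutions for every ν ⇒ HasGlobal at every κ ⇒ ¬NoGlobalCascade
      obtain ⟨S, hS, HS⟩ := H1 ε₀ h0 (hle.trans (min_le_left _ _)) α hα hO hD
      obtain ⟨η, hη, Hη⟩ := HS X₀
      have hvisc : ∀ ν : ℝ, 0 < ν → ∃ X : Fin 4 → ℤ → ℝ → ℝ,
          Literature.Analysis.FluidPDE.TaoCascade.ViscousGlobal ε₀ ν α X₀ X := fun ν hν =>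
        hB ε₀ η R h0 hη α hα S hS X₀ ν hν (fun T hT => by
          obtain ⟨C, hC⟩ := Hη T hT
          exact ⟨C, hC ν hν⟩)
      rw [Literature.Analysis.FluidPDE.TaoCascade.noGlobalCascade_iff_kappa h0]
      rintro ⟨κ, hκ, hnot⟩
      apply hnot
      have h2 : 0 < Real.sqrt 2 := Real.sqrt_pos.2 two_pos
      obtain ⟨X, hX⟩ := hvisc (κ / Real.sqrt 2) (div_pos hκ h2)
      have hG := Literature.Analysis.FluidPDE.TaoCascade.hasGlobal_of_viscousGlobal h0 (div_pos hκ h2).le hX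
      rw [div_mul_cancel₀ κ h2.ne'] at hG
      exact Literature.Analysis.FluidPDE.TaoCascade.hasGlobal_mono h0.le hG le_rfl hκ.le
    · exact H3 ε₀ h0 ((hle.trans (min_le_right _ _)).trans (min_le_left _ _)) α X₀ hα hO hD
  · exact H2 ε₀ h0 ((hle.trans (min_le_right _ _)).trans (min_le_right _ _)) α X₀ hα hO

end Summit.NavierStokesRegularity.NavierStokesRegularity.Theses.SubcriticalEnvelope
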